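import Summits.MatrixMultiplication.MatrixMultiplication.Theorems.FarEdgeDescentRankOneCoupling
import HarnessLib

/-!
# Far-edge descent, Kernel X-c — the zero-weight member of the BCZ line

Support for `Summit.MatrixMultiplication.MatrixMultiplication.Theses.FarEdgeDescent`
(aside `SubLogRate`; lens «structural dichotomy (special vs generic)», generation 35).

The member `𝔖(0) = fam K 0` of the weight family is the one point of the stratum line to which the
Cohn–Umans door (`summit_of_asymptoticRank_fam_le_four`, `q ≠ 0`) and the quantum floor
`four_le_spectralPoint_weightedStar` (all weights nonzero) do not apply.  It is the *special*
member in the classical sense: `𝔖(0)` is BCZ's `⟨2,2,2⟩₀`, of rank `≤ 6` by De Groote's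
observation that Strassen's algorithm, after a basis change, contains the missing term
`a₂₁ b₁₂ → c₂₂` as one of its seven products [BCZ17, proof of Thm. 2 via (sandwich)].  This file
records, over an arbitrary field,

* the **flattening floor for every member**: the four first-leg slices of `𝔖(q)` are linearly
  independent, so `flatteningRank (𝔖(q)) = 4` and `4 ≤ R̃(𝔖(q))`, `4 ≤ R(𝔖(q))` for **all** `q`
  (including `q = 0`; `four_le_asymptoticRank_fam`);
* **De Groote's six triads**: an explicit decomposition `𝔖(0) = ∑_{s<6} z_s ⊗ x_s ⊗ y_s`
  (`fam_zero_eq_sum_triad`), hence `R(𝔖(0)) ≤ 6`, and with the rank-one coupling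
  `R(𝔖(q)) ≤ 7` for every `q` (Strassen's bound on the whole line, `tensorRank_fam_le_seven`);
* over `ℂ`: the window `max(4, 2^ω − 1) ≤ R̃(𝔖(0)) ≤ min(6, 2^ω + 1)` and the additive door at the
  zero-weight member, `R̃(𝔖(0)) ≤ 3 + ε`-type bounds being excluded by the floor: the only
  summit-relevant event at `q = 0` is `R̃(𝔖(0)) < 2^ω`, i.e. `q = 0` being `R̃`-special.

## References

* M. Bläser, M. Christandl, J. Zuiddam, *The border support rank of two-by-two matrix
  multiplication is seven*, arXiv:1705.09652 (2017), §2: Thm. 4 (De Groote), Def. 5, proof of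
  Thm. 2 ("(sandwich) gives `R(⟨2,2,2⟩₀) ≤ 6` and thus `R(⟨2,2,2⟩_q) ≤ 7` for all `q`").
  [BlaserChristandlZuiddam2017]
* H. F. de Groote, *On varieties of optimal algorithms for the computation of bilinear mappings
  II*, Theoret. Comput. Sci. 7 (1978). [deGroote1978]
* V. Strassen, *Gaussian elimination is not optimal*, Numer. Math. 13 (1969). [Strassen1969]
* P. Bürgisser, M. Clausen, M. A. Shokrollahi, *Algebraic Complexity Theory* (1997), (14.8)
  (flattening rank `≤` rank). [BurgisserClausenShokrollahi1997]
-/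

noncomputable section

open scoped BigOperators

set_option linter.dupNamespace false

namespace Summit.MatrixMultiplication.MatrixMultiplication.Theorems.FarEdgeDescentZeroWeightMember

open Literature.Computability.AlgebraicComplexity
open Literature.Barriers.MatrixMultiplication (flatteningRank_le_asymptoticRank)
open Summit.MatrixMultiplication.MatrixMultiplication.Theorems.FarEdgeDescentSignTwist
open Summit.MatrixMultiplication.MatrixMultiplication.Theorems.FarEdgeDescentSignTwistDet
open Summit.MatrixMultiplication.MatrixMultiplication.Theorems.FarEdgeDescentWeightFamily
open Summit.MatrixMultiplication.MatrixMultiplication.Theorems.FarEdgeDescentGenericDomination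
open Summit.MatrixMultiplication.MatrixMultiplication.Theorems.FarEdgeDescentRankOneCoupling

/-! ## §1 The flattening floor `4 ≤ R̃(𝔖(q))` for every member -/

section Floor

variable {K : Type} [Field K]

/-- **The four first-leg slices of `𝔖(q)` are linearly independent** for every `q`: slice
`inl (i,0)` is the only one supported at `((i,0), inl (0,0))`, slice `inr (i,0)` the only one at
`((i,1), inr (1,0))` (an entry of weight `famW q (i,1) = 1`). [cite: BurgisserClausenShokrollahi1997, (14.8)] -/
theorem linearIndependent_xSlices_fam (q : K) : LinearIndependent K (xSlices (fam K q)) := by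
  rw [Fintype.linearIndependent_iff]
  intro g hg
  have key : ∀ p : (Fin 2 × Fin 2) × Leaf2, ∑ a, g a * fam K q a p.1 p.2 = 0 := fun p => by
    have h := congrFun hg p
    simpa [Finset.sum_apply, Pi.smul_apply, smul_eq_mul, xSlices] using h
  have e₁ := key (((0 : Fin 2), (0 : Fin 2)), Sum.inl ((0 : Fin 2), (0 : Fin 1)))
  have e₂ := key (((1 : Fin 2), (0 : Fin 2)), Sum.inl ((0 : Fin 2), (0 : Fin 1)))
  have e₃ := key (((0 : Fin 2), (1 : Fin 2)), Sum.inr ((1 : Fin 2), (0 : Fin 1)))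
  have e₄ := key (((1 : Fin 2), (1 : Fin 2)), Sum.inr ((1 : Fin 2), (0 : Fin 1)))
  simp [Fintype.sum_sum_type, Fintype.sum_prod_type, matMulTensor, famW] at e₁ e₂ e₃ e₄
  intro a
  rcases a with ⟨i, l⟩ | ⟨i, l⟩ <;> fin_cases i <;> fin_cases l <;> simp_all

/-- **`flatteningRank (𝔖(q)) = 4`** for every `q`. [cite: BurgisserClausenShokrollahi1997, (14.8)] -/
theorem flatteningRank_fam (q : K) : flatteningRank (fam K q) = 4 := by
  unfold flatteningRank
  rw [finrank_span_eq_card (linearIndependent_xSlices_fam q)]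
  simp

/-- **Flattening floor `4 ≤ R̃(𝔖(q))` for every member `q`, over any field** — in particular at
the zero-weight member `q = 0`, where the quantum-functional floor of `FarEdgeDescentStratumPinning`
(all weights nonzero) is not available. [cite: BurgisserClausenShokrollahi1997, (14.8); Strassen1988, §4] -/
theorem four_le_asymptoticRank_fam (q : K) : (4 : ℝ) ≤ asymptoticRank (fam K q) := by
  have h := flatteningRank_le_asymptoticRank (fam K q)
  rw [flatteningRank_fam q] at h
  exact_mod_cast h

/-- **`4 ≤ R(𝔖(q))` for every `q`.** [cite: BurgisserClausenShokrollahi1997, (14.8)] -/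
theorem four_le_tensorRank_fam (q : K) : 4 ≤ tensorRank (fam K q) := by
  have h := flatteningRank_le_tensorRank (fam K q)
  rwa [flatteningRank_fam q] at h

end Floor

/-! ## §2 De Groote's six triads for the zero-weight member -/

section DeGroote

variable {K : Type} [Field K]

/-- A coefficient vector on `Leaf2`, listed as `(inl (0,0), inl (1,0), inr (0,0), inr (1,0))` —
the entries `(·)₁₁, (·)₂₁, (·)₁₂, (·)₂₂` of a `2 × 2` matrix split by columns. [folklore] -/
def vecL (x₁ x₂ x₃ x₄ : K) : Leaf2 → K := fun a =>
  Sum.elim (fun p : Fin 2 × Fin 1 => if p.1 = 0 then x₁ else x₂)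
    (fun p : Fin 2 × Fin 1 => if p.1 = 0 then x₃ else x₄) a

/-- A coefficient vector on the middle index set `Fin 2 × Fin 2`, listed as
`((0,0), (0,1), (1,0), (1,1))`. [folklore] -/
def vecM (y₁ y₂ y₃ y₄ : K) : Fin 2 × Fin 2 → K := fun b =>
  if b.1 = 0 then (if b.2 = 0 then y₁ else y₂) else (if b.2 = 0 then y₃ else y₄)

/-- First-leg factors of De Groote's six triads (Strassen's products `M₁, M₂, M₄, M₅, M₆, M₇` after
the basis change `A ↦ PA`, `B ↦ BQ`, `C ↦ PCQ` with `P = [[0,1],[1,1]]`, `Q = [[1,1],[0,1]]`, which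
turns `M₃` into the single missing product `a₂₁ b₁₂ → c₂₂`). [cite: BlaserChristandlZuiddam2017, Thm. 4] -/
def dgZ : Fin 6 → Leaf2 → K :=
  ![vecL (-1) 1 1 0, vecL 1 0 (-1) 0, vecL 0 1 0 0, vecL 1 (-1) (-1) 1, vecL 0 0 1 0, vecL (-1) 1 0 0]

/-- Middle-leg factors of De Groote's six triads. [cite: BlaserChristandlZuiddam2017, Thm. 4] -/
def dgX : Fin 6 → Fin 2 × Fin 2 → K :=
  ![vecM (-1) 1 0 1, vecM 0 1 0 1, vecM 1 (-1) 1 (-1), vecM 0 0 0 1, vecM 1 0 0 0, vecM 1 (-1) 0 0]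

/-- Third-leg factors of De Groote's six triads. [cite: BlaserChristandlZuiddam2017, Thm. 4] -/
def dgY : Fin 6 → Leaf2 → K :=
  ![vecL 1 1 0 1, vecL 1 1 0 0, vecL 1 0 0 0, vecL 0 0 0 1, vecL 1 1 1 1, vecL 0 1 0 1]

/-- **De Groote's decomposition: `𝔖(0)` is a sum of six triads** (checked entrywise on the
`4 × 4 × 4` format). [cite: BlaserChristandlZuiddam2017, Thm. 4 and proof of Thm. 2; deGroote1978] -/
theorem fam_zero_eq_sum_triad :
    fam K 0 = ∑ s : Fin 6, triad (dgZ s) (dgX s) (dgY (K := K) s) := by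
  funext a b c
  obtain ⟨b₁, b₂⟩ := b
  simp only [Finset.sum_apply, Fin.sum_univ_six, triad_apply, dgZ, dgX, dgY, vecL, vecM,
    Matrix.cons_val]
  rcases a with ⟨i, l⟩ | ⟨i, l⟩ <;> rcases c with ⟨k, l'⟩ | ⟨k, l'⟩ <;> fin_cases i <;> fin_cases k <;>
    fin_cases b₁ <;> fin_cases b₂ <;> fin_cases l <;> fin_cases l' <;>
    simp [matMulTensor, famW]

/-- **`R(𝔖(0)) ≤ 6`** over every field (De Groote / BCZ `R(⟨2,2,2⟩₀) ≤ 6`).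
[cite: BlaserChristandlZuiddam2017, proof of Thm. 2; deGroote1978] -/
theorem tensorRank_fam_zero_le_six : tensorRank (fam K 0) ≤ 6 :=
  (tensorRank_le_card_of_eq_sum _ _ _ (fam_zero_eq_sum_triad (K := K))).trans_eq (Fintype.card_fin 6)

/-- **`R(𝔖(q)) ≤ 7` for every `q`** — Strassen's bound on the whole stratum line, as De Groote's six
triads plus the rank-one direction `q • E`. [cite: BlaserChristandlZuiddam2017, proof of Thm. 2; Strassen1969] -/
theorem tensorRank_fam_le_seven (q : K) : tensorRank (fam K q) ≤ 7 := by
  rw [fam_eq_add_smul q 0, sub_zero]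
  calc tensorRank (fam K 0 + q • (fam K 1 - fam K 0))
      ≤ tensorRank (fam K 0) + tensorRank (q • (fam K 1 - fam K 0)) := tensorRank_add_le _ _
    _ ≤ 6 + 1 := add_le_add tensorRank_fam_zero_le_six
        ((tensorRank_smul_le q _).trans tensorRank_fam_one_sub_fam_zero_le)

/-- **`4 ≤ R(𝔖(0)) ≤ 6`.** [cite: BlaserChristandlZuiddam2017, §2] -/
theorem tensorRank_fam_zero_mem : 4 ≤ tensorRank (fam K 0) ∧ tensorRank (fam K 0) ≤ 6 :=
  ⟨four_le_tensorRank_fam 0, tensorRank_fam_zero_le_six⟩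

/-- **`R̃(𝔖(0)) ≤ 6`** over every field. [cite: BlaserChristandlZuiddam2017, §2; Strassen1988, Thm. 3.9] -/
theorem asymptoticRank_fam_zero_le_six : asymptoticRank (fam K 0) ≤ 6 := by
  obtain ⟨F, hF, hFt⟩ := (strassen_duality_asymptoticRank_holds K (fam K 0)).2
  rw [← hFt]
  exact (hF.le_tensorRank _).trans (by exact_mod_cast tensorRank_fam_zero_le_six)

end DeGroote

/-! ## §3 Over `ℂ`: the zero-weight member's window -/

section Complex

/-- **Window for the zero-weight member**: `max(4, 2^ω − 1) ≤ R̃(𝔖(0)) ≤ min(6, 2^ω + 1)`.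
[cite: BlaserChristandlZuiddam2017, §2; ChristandlHoeberechtsNieuwboerVranaZuiddam2025, §1.2] -/
theorem asymptoticRank_fam_zero_window :
    max 4 ((2 : ℝ) ^ omega ℂ - 1) ≤ asymptoticRank (fam ℂ 0) ∧
      asymptoticRank (fam ℂ 0) ≤ min 6 ((2 : ℝ) ^ omega ℂ + 1) :=
  ⟨max_le (four_le_asymptoticRank_fam 0) (rpow_omega_sub_one_le_asymptoticRank_fam 0),
    le_min asymptoticRank_fam_zero_le_six (asymptoticRank_fam_le_rpow_omega_add_one 0)⟩

/-- **Every member lies in `[4, 2^ω + 1]`** (flattening floor and rank-one coupling), and a dominant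
member in `[max(4, 2^ω), 2^ω + 1]`. [cite: BlaserChristandlZuiddam2017, §2] -/
theorem asymptoticRank_fam_window (q : ℂ) :
    (4 : ℝ) ≤ asymptoticRank (fam ℂ q) ∧ asymptoticRank (fam ℂ q) ≤ (2 : ℝ) ^ omega ℂ + 1 :=
  ⟨four_le_asymptoticRank_fam q, asymptoticRank_fam_le_rpow_omega_add_one q⟩

/-- **Additive door at the zero-weight member**: `R̃(𝔖(0)) ≤ r ⟹ ω ≤ log₂ (r + 1)`; e.g.
`R̃(𝔖(0)) = 4` (its floor) would give `ω ≤ log₂ 5 < 2.33`. [cite: BlaserChristandlZuiddam2017, §2] -/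
theorem omega_le_logb_of_asymptoticRank_fam_zero_le {r : ℝ} (h : asymptoticRank (fam ℂ 0) ≤ r) :
    omega ℂ ≤ Real.logb 2 (r + 1) :=
  omega_le_logb_of_asymptoticRank_fam_le 0 h

/-- **Under `ω = 2`: `4 ≤ R̃(𝔖(q)) ≤ 5` for every member**, the zero-weight one included.
[cite: BlaserChristandlZuiddam2017, §2] -/
theorem asymptoticRank_fam_mem_Icc_of_summit (hS : _root_.MatrixMultiplication) (q : ℂ) :
    (4 : ℝ) ≤ asymptoticRank (fam ℂ q) ∧ asymptoticRank (fam ℂ q) ≤ 5 :=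
  ⟨four_le_asymptoticRank_fam q, asymptoticRank_fam_le_five_of_summit hS q⟩

/-- **The zero-weight member is `R̃`-special iff `R̃(𝔖(0)) < 2^ω`**; by the window this is the
only way `q = 0` can fail to be dominant by more than the coupling allows: either
`R̃(𝔖(0)) ∈ [2^ω − 1, 2^ω)` (special) or `R̃(𝔖(0)) ∈ [2^ω, 2^ω + 1]`. [cite: BlaserChristandlZuiddam2017, §2] -/
theorem fam_zero_special_or :
    ((2 : ℝ) ^ omega ℂ - 1 ≤ asymptoticRank (fam ℂ 0) ∧ asymptoticRank (fam ℂ 0) < (2 : ℝ) ^ omega ℂ) ∨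
      ((2 : ℝ) ^ omega ℂ ≤ asymptoticRank (fam ℂ 0) ∧
        asymptoticRank (fam ℂ 0) ≤ (2 : ℝ) ^ omega ℂ + 1) := by
  rcases lt_or_ge (asymptoticRank (fam ℂ 0)) ((2 : ℝ) ^ omega ℂ) with h | h
  · exact Or.inl ⟨rpow_omega_sub_one_le_asymptoticRank_fam 0, h⟩
  · exact Or.inr ⟨h, asymptoticRank_fam_le_rpow_omega_add_one 0⟩

end Complex

end Summit.MatrixMultiplication.MatrixMultiplication.Theorems.FarEdgeDescentZeroWeightMember

end
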